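/-
Copyright: cell pub-balaban-gaps (YM BLITZ Y1, track G1), seat g1-p2 GEN 11 (unit `pub-balaban-gaps-g1-p2`).  Row (D4) NODE O, MODEL level:
the COLUMN twins of `D4WalkBlockTransportAlgebra`'s fibre ROW-mass windows for the adjoint-representation defects `conjOp U U⁻ − 1`
(bond) and `(conjOp U U⁻ − 1) + (conjOp V⁻ V − 1)` (divergence) — the FORM-currency chain (109 ∕ 113 ∕ 114) consumes the multipliers' conjugated
ROW AND COLUMN sums, and 66's (3.37) letters (`bond_letters`, `deriv_letters`) bound rows AND columns of `U^± − 1`, so the column windows cost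
nothing new: `colMass (conjOp M M′) (a′, b′) = colSum(M)_{a′}·rowSum(M′)_{b′}`.  HONEST FRAMING: bookkeeping ([folklore]); nothing of
Bałaban's asserted; (D4) instance 0∕1; NOT BetaPertH, NOT continuum, NOT Clay.
-/
import Summits.QuantumFields.BalabanUV.Gaps.D4WalkBlockTransportAlgebra

/-!
# `Gaps.D4WalkBlockAdjointWindowCol` — column masses of the adjoint transport defects from the bond letters (cell pub-balaban-gaps, seat g1-p2 gen 11)

HONEST DEPENDENCY (cell pub-balaban, verbatim): continuum YM on T⁴ ⇐ BetaPertH ∧ nine spine estimates (0/9 proved); BetaPertH ⇐ (D1) ∧ (D4) ∧ CAP+tail.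

[B9] (3.37) p. 396, (3.51)–(3.54) pp. 400–401 (the windows on the gauge field and the structure of the defects).  ([folklore] throughout):
* `colMass_conjOp` (`Σ_p ‖conjOp M M′ p (a′,b′)‖ = colSum(M)_{a′}·rowSum(M′)_{b′}`), `colMass_add_le`, `colMass_sub_le`, `colMass_sum_le`;
* **`colMass_defect_le_of_letters`** (column sums of `U − 1` and row sums of `U⁻ − 1` at most `δ` ⟹ column mass of `conjOp U U⁻ − 1` at most
  `δ(1 + δ) + δ`);
* **`colMass_defect_pair_le`** (the divergence: column mass of `(conjOp U U⁻ − 1) + (conjOp V⁻ V − 1)` at most `2δ′ + 4δ²` under the two-sided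
  letters `δ` and the derivative letters `δ′` — `D4WalkBlockTransportAlgebra.defect_pair_eq` BY NAME).
WHAT IT IS NOT.  The windows themselves (66); (D4) instance 0∕1; words of row (D4) UNCHANGED.

References (method only): T. Bałaban, Comm. Math. Phys. **99** (1985) 389–434 [B9], (3.37) p. 396, (3.51)–(3.54) pp. 400–401.
-/

noncomputable section

namespace Summit.QuantumFields.BalabanUV.Gaps.D4WalkBlockAdjointWindowCol

open Finset Complex Matrix
open scoped BigOperators Matrix
open Summit.QuantumFields.BalabanUV.Gaps.D4WalkBlockTransportAlgebra (conjOp rowSumNorm colSumNorm rowSumNorm_nonneg colSumNorm_nonneg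
  conjOp_sub_one defect_pair_eq colSumNorm_mul_le rowSumNorm_mul_le conjOp_one_one)

variable {N : ℕ}

/-- **column mass of `conjOp M M′`** at column `(a′, b′)` = `colSum(M)_{a′} · rowSum(M′)_{b′}`. -/
theorem colMass_conjOp (M M' : Matrix (Fin N) (Fin N) ℂ) (a' b' : Fin N) :
    ∑ p : Fin N × Fin N, ‖conjOp M M' p (a', b')‖ = colSumNorm M a' * rowSumNorm M' b' := by
  simp only [conjOp, Matrix.of_apply, norm_mul, rowSumNorm, colSumNorm]
  rw [Fintype.sum_prod_type, Finset.sum_mul]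
  exact Finset.sum_congr rfl fun c _ => by rw [Finset.mul_sum]

/-- column masses are subadditive. -/
theorem colMass_add_le (A B : Matrix (Fin N × Fin N) (Fin N × Fin N) ℂ) (q : Fin N × Fin N) :
    ∑ p, ‖(A + B) p q‖ ≤ ∑ p, ‖A p q‖ + ∑ p, ‖B p q‖ := by
  rw [← Finset.sum_add_distrib]; exact Finset.sum_le_sum fun p _ => norm_add_le _ _

/-- column masses of a difference. -/
theorem colMass_sub_le (A B : Matrix (Fin N × Fin N) (Fin N × Fin N) ℂ) (q : Fin N × Fin N) :
    ∑ p, ‖(A - B) p q‖ ≤ ∑ p, ‖A p q‖ + ∑ p, ‖B p q‖ := by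
  rw [← Finset.sum_add_distrib]; exact Finset.sum_le_sum fun p _ => norm_sub_le _ _

/-- column masses of a finite sum. -/
theorem colMass_sum_le {ι : Type*} (s : Finset ι) (A : ι → Matrix (Fin N × Fin N) (Fin N × Fin N) ℂ) (q : Fin N × Fin N) :
    ∑ p, ‖(∑ i ∈ s, A i) p q‖ ≤ ∑ i ∈ s, ∑ p, ‖A i p q‖ := by
  calc ∑ p, ‖(∑ i ∈ s, A i) p q‖ = ∑ p, ‖∑ i ∈ s, A i p q‖ := Finset.sum_congr rfl fun p _ => by rw [Matrix.sum_apply]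
    _ ≤ ∑ p, ∑ i ∈ s, ‖A i p q‖ := Finset.sum_le_sum fun p _ => norm_sum_le _ _
    _ = ∑ i ∈ s, ∑ p, ‖A i p q‖ := Finset.sum_comm

/-- the column sum of the identity is one. -/
theorem colSumNorm_one (b : Fin N) : colSumNorm (1 : Matrix (Fin N) (Fin N) ℂ) b = 1 := by
  simp only [colSumNorm, Matrix.one_apply]
  rw [Finset.sum_eq_single b (fun d _ hd => by rw [if_neg hd, norm_zero]) (fun h => (h (Finset.mem_univ b)).elim)]
  simp

/-- the row sum of the identity is one. -/
theorem rowSumNorm_one (a : Fin N) : rowSumNorm (1 : Matrix (Fin N) (Fin N) ℂ) a = 1 := by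
  simp only [rowSumNorm, Matrix.one_apply]
  rw [Finset.sum_eq_single a (fun c _ hc => by rw [if_neg (Ne.symm hc), norm_zero]) (fun h => (h (Finset.mem_univ a)).elim)]
  simp

/-- **the bond window, COLUMN form**: column sums of `U − 1` and row sums of `U′ − 1` at most `δ ≥ 0` ⟹ column mass of `conjOp U U′ − 1` at column
`(a′, b′)` at most `δ(1 + δ) + δ` (`rowSum(U′) ≤ 1 + δ`). -/
theorem colMass_defect_le_of_letters (U U' : Matrix (Fin N) (Fin N) ℂ) {δ : ℝ} (hδ : 0 ≤ δ)
    (hU : ∀ a, colSumNorm (U - 1) a ≤ δ) (hU' : ∀ b, rowSumNorm (U' - 1) b ≤ δ) (a' b' : Fin N) :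
    ∑ p, ‖(conjOp U U' - 1) p (a', b')‖ ≤ δ * (1 + δ) + δ := by
  have hrow : rowSumNorm U' b' ≤ 1 + δ := by
    have e : U' = 1 + (U' - 1) := by abel
    calc rowSumNorm U' b' = rowSumNorm (1 + (U' - 1)) b' := by rw [← e]
      _ ≤ rowSumNorm (1 : Matrix (Fin N) (Fin N) ℂ) b' + rowSumNorm (U' - 1) b' := by
          unfold rowSumNorm; rw [← Finset.sum_add_distrib]
          exact Finset.sum_le_sum fun d _ => by rw [Matrix.add_apply]; exact norm_add_le _ _
      _ ≤ 1 + δ := by rw [rowSumNorm_one]; exact add_le_add le_rfl (hU' b')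
  rw [conjOp_sub_one]
  refine (colMass_add_le _ _ _).trans ?_
  rw [colMass_conjOp, colMass_conjOp, colSumNorm_one, one_mul]
  exact add_le_add (mul_le_mul (hU a') hrow (rowSumNorm_nonneg _ _) hδ) (hU' b')

/-- **the divergence window, COLUMN form**: under the two-sided letters `δ ≥ 0` of `U − 1`, `U⁻ − 1`, `V − 1`, `V⁻ − 1` and the letters `δ′` of the
discrete derivative `U − V`, the column mass of `(conjOp U U⁻ − 1) + (conjOp V⁻ V − 1)` is at most `2δ′ + 4δ²`. [cite: Balaban1985BackgroundPropagators, (3.54) p.401, (3.37) p.396] -/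
theorem colMass_defect_pair_le (U Ui V Vi : Matrix (Fin N) (Fin N) ℂ) (hU : U * Ui = 1) (hV : Vi * V = 1) {δ δ' : ℝ} (hδ : 0 ≤ δ)
    (hUr : ∀ a, rowSumNorm (U - 1) a ≤ δ) (hUc : ∀ b, colSumNorm (U - 1) b ≤ δ) (hUir : ∀ a, rowSumNorm (Ui - 1) a ≤ δ)
    (hVr : ∀ a, rowSumNorm (V - 1) a ≤ δ) (hVc : ∀ b, colSumNorm (V - 1) b ≤ δ) (hVic : ∀ b, colSumNorm (Vi - 1) b ≤ δ)
    (hDr : ∀ a, rowSumNorm (U - V) a ≤ δ') (hDc : ∀ b, colSumNorm (U - V) b ≤ δ') (a' b' : Fin N) :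
    ∑ p, ‖((conjOp U Ui - 1) + (conjOp Vi V - 1)) p (a', b')‖ ≤ 2 * δ' + 4 * δ ^ 2 := by
  -- first order: 2δ′
  have t1 : ∑ p, ‖(conjOp (U - V) 1 - conjOp 1 (U - V)) p (a', b')‖ ≤ 2 * δ' := by
    refine (colMass_sub_le _ _ _).trans ?_
    rw [colMass_conjOp, colMass_conjOp, rowSumNorm_one, colSumNorm_one, mul_one, one_mul]
    linarith [hDc a', hDr b']
  -- second order: each term ≤ δ²
  have t2 : ∑ p, ‖(conjOp (U - 1) (Ui - 1)) p (a', b')‖ ≤ δ ^ 2 := by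
    rw [colMass_conjOp, pow_two]; exact mul_le_mul (hUc a') (hUir b') (rowSumNorm_nonneg _ _) hδ
  have t3 : ∑ p, ‖(conjOp 1 ((U - 1) * (Ui - 1))) p (a', b')‖ ≤ δ ^ 2 := by
    rw [colMass_conjOp, colSumNorm_one, one_mul, pow_two]
    exact (rowSumNorm_mul_le _ _ hUir b').trans (mul_le_mul_of_nonneg_right (hUr b') hδ)
  have t4 : ∑ p, ‖(conjOp (Vi - 1) (V - 1)) p (a', b')‖ ≤ δ ^ 2 := by
    rw [colMass_conjOp, pow_two]; exact mul_le_mul (hVic a') (hVr b') (rowSumNorm_nonneg _ _) hδ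
  have t5 : ∑ p, ‖(conjOp ((Vi - 1) * (V - 1)) 1) p (a', b')‖ ≤ δ ^ 2 := by
    rw [colMass_conjOp, rowSumNorm_one, mul_one, pow_two]
    exact (colSumNorm_mul_le _ _ hVic a').trans (mul_le_mul_of_nonneg_left (hVc a') hδ)
  have t25 := (colMass_sub_le _ _ (a', b')).trans (add_le_add ((colMass_add_le _ _ (a', b')).trans (add_le_add
    ((colMass_sub_le _ _ (a', b')).trans (add_le_add t2 t3)) t4)) t5)
  rw [defect_pair_eq U Ui V Vi hU hV]
  refine ((colMass_add_le _ _ (a', b')).trans (add_le_add t1 t25)).trans (le_of_eq ?_)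
  ring

end Summit.QuantumFields.BalabanUV.Gaps.D4WalkBlockAdjointWindowCol

end
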